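import Summits.BirchSwinnertonDyer.BirchSwinnertonDyer.Theses.InertBadSignedBranches
import Summits.BirchSwinnertonDyer.Rank1Residual.X12.InertBadOddPrime
import Summits.BirchSwinnertonDyer.Rank1Residual.X12.CMTamagawaThreeAll
import Summits.BirchSwinnertonDyer.Rank1Residual.X12.ClassClosureO10RubinEta
import Summits.BirchSwinnertonDyer.Rank1Residual.X12.CMDeuringTwo
import Literature.NumberTheory.EllipticCurves.ManinConstantModularDegree
import Literature.NumberTheory.EllipticCurves.ModularityVersionApProofs
import HarnessLib

/-!
# Route `InertBadSignedBranches` (rung K8), D71 child `InertBadAtThreeIstarZero` (stmt-BirchSwinnertonDyer-19656):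
# the Manin datum at `3` READ OFF THE MODULAR DEGREE (Česnavičius–Neururer–Saha) on the type `(3, I₀*)`
# (helper `--supports` 19656; cell `bsd-cm`, seat `bsd-cm-k8i-c41` g3; theorems only, nothing asserted)

HONEST FRAMING (cell `bsd-cm`, run/shared/lean/pub/bsd-cm/): Birch–Swinnerton-Dyer is NOT proved by
any of this. The item `InertBadAtThreeIstarZero` is OPEN at class level and stays so. This file is
about the ONE non-fact input of the Kolyvagin-side normal form at `3` (inert g11, p416932:
child ⟸ `LowerHalfOnType 3 I₀*` + eight published facts + the MANIN DATUM `3 ∤ c(D)` on the type).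
READING (seat g3, NOTES §Manin@3): at CLASS level that datum is in NO source — Mazur 1978 needs
`9 ∤ N`, Edixhoven 1991 Thm. 3 needs `p ≥ 11` (x1b's Manin-free core `InertCoreManinFree.lean`),
Agashe–Ribet–Stein 2006 §2 lists nothing at an additive `3`; PER PAIR it has been read off Cremona's
`c = 1` for the OPTIMAL curve (ARS06 Thm. 2.6 / the typed `≤ 300000` sentence / `opt_man`), which needs
the optimal curve of the class to be determined. Česnavičius–Neururer–Saha, JEMS 26 (2024) Thm. 1.2
(tree fact `cesnaviciusNeururerSaha_padicVal_maninConstant_le_modularDegree`; optimality NOT assumed)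
gives the datum from the MODULAR DEGREE instead: `val₃(c_φ) ≤ val₃(deg φ)` as soon as some prime
`q ≡ 2 (mod 3)` divides `N` — automatic for every curve BAD at `2`, i.e. for the whole `ℚ(i)`-part of
the type (`4 ∣ N`; 143 of the 154 O10@3 census classes). CENSUS (Cremona `alldegphi`, this seat's
`census/degphi3.tsv`): `3 ∤ deg φ₁` on 22/57 O10-PS@3 classes (and 19/97 O10-SC@3) — so this is a
PER-PAIR lever, not a class-level one; it meets the Manin input of `484416bw1` (PS@3; optimality
undetermined in `opt_man`; `deg = 716800 = 2¹²·5²·7`) and `484128e1` (SC@3; `deg = 1088000`), two of the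
four O10@3 classes N18 v1.2 lists as Manin-pending. THEOREMS ONLY: 0 definitions, 0 named facts
minted, 0 `sorry`.

PARTITION (D-0054): CornerF inert-bad (B12 / O10) × O10-PS@3 (57 classes of signed type `(3, I₀*)`;
the sub-part «bad at `2` ∧ `3 ∤ deg φ`») × `p = 3` — types-the-object-of; closes no cell, books nothing,
moves no mark.

* §1 `not_three_dvd_maninConstant_of_not_good_two_of_not_dvd_modularDegree` — globally minimal `W/ℚ`
  BAD at `2`, any parametrisation datum `D` at the conductor level with `3 ∤ deg(D)` ⟹ `3 ∤ c(D)`.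
* §2 `missingInputAt_three_IstarZero_of_shaAn_unit_of_modularDegree` — route T-KR@3 on the type
  `(3, I₀*)` with the Manin datum REPLACED by (bad at `2` ∧ `3 ∤ deg(D)`): published facts (+ CNS) +
  certified `r_an = 1`, `ord₃ #Ш_an = 0` ⟹ `Typed.X12.MissingInputAt W 3`; `bsdp_three_IstarZero_…` likewise;
  and `missingInputAt_three_IstarZero_of_lower_of_modularDegree` — the same with the pair's own LOWER
  half in place of the `#Ш_an` certificate (the per-pair form of p416932 §1 with the degree datum).

References (locators only): [CesnaviciusNeururerSaha2023] Thm. 1.2; [MatarNekovar2019] Thm. 0.3, §0.11;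
[Miller2011LMS] §1, Def. 1.1; [AgasheRibetStein2006] §2; [Cremona1997] `alldegphi` / `opt_man`.
-/

set_option autoImplicit false
set_option linter.dupNamespace false

noncomputable section

open scoped Classical NumberField

open WeierstrassCurve NumberField IsDedekindDomain
open Literature.NumberTheory.EllipticCurves
open Literature.NumberTheory.EllipticCurves.ModularForms
open Literature.NumberTheory.EllipticCurves.Rank1Residual
open Literature.NumberTheory.EllipticCurves.Rank1Residual.Typed
open Summit.BirchSwinnertonDyer.Rank1Residual
open Summit.BirchSwinnertonDyer.Rank1Residual.X12
open Summit.BirchSwinnertonDyer.Rank1Residual.X12.O10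

namespace Summit.BirchSwinnertonDyer.BirchSwinnertonDyer.Theorems.InertBadManinDegree

/-! ## §1 `3 ∤ c(D)` from `3 ∤ deg(D)` for a curve bad at `2` (Česnavičius–Neururer–Saha) -/

/-- **`3 ∤ c(D)` from `3 ∤ deg(D)` for a curve bad at `2`.** For a globally minimal `W/ℚ` with bad
reduction at `2` (so `2 ∣ N_W`, and `2 ≡ 2 (mod 3)` voids the exceptional clause of CNS Thm. 1.2 at
the prime `3`) and any parametrisation datum `D` at the conductor level: `3 ∤ deg(D) ⟹ 3 ∤ c(D)`.
CONDITIONAL on the named fact `cesnaviciusNeururerSaha_padicVal_maninConstant_le_modularDegree`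
(`hCNS`). [cite: CesnaviciusNeururerSaha2023, Thm. 1.2] -/
theorem not_three_dvd_maninConstant_of_not_good_two_of_not_dvd_modularDegree
    (hCNS : cesnaviciusNeururerSaha_padicVal_maninConstant_le_modularDegree)
    (W : WeierstrassCurve ℚ) [W.IsElliptic] [W.IsGloballyMinimal] [NeZero (W.conductorNorm ℤ)]
    (hbad2 : ¬ W.HasGoodReductionAtPrime 2)
    (D : ModularParametrizationData W (W.conductorNorm ℤ)) (hdeg : ¬ 3 ∣ D.modularDegree) :
    ¬ (3 : ℤ) ∣ D.c :=
  haveI : Fact (Nat.Prime 2) := ⟨Nat.prime_two⟩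
  not_three_dvd_maninConstant_of_not_dvd_modularDegree hCNS W D
    (Or.inr ⟨2, Nat.prime_two, (W.dvd_conductorNorm_iff_not_hasGoodReductionAtPrime 2).mpr hbad2, rfl⟩)
    hdeg

/-! ## §2 Route T-KR@3 on the type `(3, I₀*)` with the Manin input from the degree -/

section Facts

/-! The PUBLISHED named facts of route T-KR@3 (exactly those of `X12/InertBadOddPrime.lean`) and CNS. -/
variable
  (hGZ : ∀ (N : ℕ) [NeZero N] (W : WeierstrassCurve ℚ) (K : Type) [Field K] [NumberField K],
    gross_zagier N W K)
  (hKo : ∀ (N : ℕ) [NeZero N] (W : WeierstrassCurve ℚ) (K : Type) [Field K] [NumberField K],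
    kolyvagin N W K)
  (hMN : ∀ (N : ℕ) [NeZero N] (W : WeierstrassCurve ℚ) (K : Type) [Field K] [NumberField K],
    MatarNekovar2019.thm03_padicValNat_card_sha_le_of_irreducible N W K)
  (hGZK : rank_eq_analyticRank_of_analyticRank_le_one) (hmod : hasEntireLFunction_rat)
  (hnf : exists_isNewformOf) (hFH : friedbergHoffstein_exists_heegnerField_split_twist_ne_zero)
  (hCM8 : bsdTriple_of_hasCM_of_L_one_ne_zero)
  (hCNS : cesnaviciusNeururerSaha_padicVal_maninConstant_le_modularDegree)

include hGZ hKo hMN hGZK hmod hnf hFH hCM8 hCNS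

/-- **Route T-KR@3 on the type `(3, I₀*)` with the Manin datum READ OFF THE MODULAR DEGREE.** For a
globally minimal `W` of signed local type `(3, I₀*)` with `r_an = 1`, BAD at `2` (automatic when the
CM field is `ℚ(i)`: `4 ∣ N`), a parametrisation datum `D` at the conductor level with `3 ∤ deg(D)`, and
a certified `3`-adic unit `#Ш(W)_an = q`: `Typed.X12.MissingInputAt W 3`. Proof: x1b's
`X12.bsdp_three_of_classX12_of_bad_of_shaAn_unit` (Kolyvagin–Matar–Nekovář over a Friedberg–Hoffstein
field, the twist's half by Rubin / Burungale–Flach) with `3 ∤ c(D)` from §1, `3 ∤ ∏ c_ℓ` from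
`not_three_dvd_tamagawaProduct_of_hasCM_of_not_cmRamified_three`, then bookkeeping (`Ш` finite by GZK).
CONDITIONAL on every displayed hypothesis; per pair; nothing booked.
[cite: CesnaviciusNeururerSaha2023, Thm. 1.2] [cite: MatarNekovar2019, Thm. 0.3 and §0.11]
[cite: Miller2011LMS, §1 and Def. 1.1] -/
theorem missingInputAt_three_IstarZero_of_shaAn_unit_of_modularDegree
    (W : WeierstrassCurve ℚ) [W.IsElliptic] [W.IsGloballyMinimal] [Fact (Nat.Prime 3)]
    [NeZero (W.conductorNorm ℤ)]
    (hT : HasSignedLocalType W 3 (.Istar 0)) (hr : W.analyticRank = 1)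
    (hbad2 : ¬ W.HasGoodReductionAtPrime 2)
    (D : ModularParametrizationData W (W.conductorNorm ℤ)) (hdeg : ¬ 3 ∣ D.modularDegree)
    {q : ℚ} (hq : shaAn W = (q : ℂ)) (hv : padicValRat 3 q = 0) :
    X12.MissingInputAt W 3 := by
  intro _
  have hB : BSDp W 3 :=
    bsdp_three_of_classX12_of_bad_of_shaAn_unit hGZ hKo hMN hGZK hmod hnf hFH hCM8 W
      (classX12_of_hasSignedLocalType W 3 hT hr) hT.2.2.1 hT.2.1.1 D
      (not_three_dvd_maninConstant_of_not_good_two_of_not_dvd_modularDegree hCNS W hbad2 D hdeg)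
      (not_three_dvd_tamagawaProduct_of_hasCM_of_not_cmRamified_three W hT.1 hT.2.1.1) hq hv
  haveI : Finite W.sha := (hGZK W (by rw [hr])).2
  exact missingPPartAt_of_bsdp W 3 hB


/-- **`BSD(W, 3)` on the type `(3, I₀*)`, Manin input from the degree** — the `BSDp` form of the
previous theorem (same hypotheses). CONDITIONAL; per pair; nothing booked.
[cite: CesnaviciusNeururerSaha2023, Thm. 1.2] [cite: MatarNekovar2019, Thm. 0.3 and §0.11] -/
theorem bsdp_three_IstarZero_of_shaAn_unit_of_modularDegree
    (W : WeierstrassCurve ℚ) [W.IsElliptic] [W.IsGloballyMinimal] [Fact (Nat.Prime 3)]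
    [NeZero (W.conductorNorm ℤ)]
    (hT : HasSignedLocalType W 3 (.Istar 0)) (hr : W.analyticRank = 1)
    (hbad2 : ¬ W.HasGoodReductionAtPrime 2)
    (D : ModularParametrizationData W (W.conductorNorm ℤ)) (hdeg : ¬ 3 ∣ D.modularDegree)
    {q : ℚ} (hq : shaAn W = (q : ℂ)) (hv : padicValRat 3 q = 0) : BSDp W 3 :=
  bsdp_three_of_classX12_of_bad_of_shaAn_unit hGZ hKo hMN hGZK hmod hnf hFH hCM8 W
    (classX12_of_hasSignedLocalType W 3 hT hr) hT.2.2.1 hT.2.1.1 D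
    (not_three_dvd_maninConstant_of_not_good_two_of_not_dvd_modularDegree hCNS W hbad2 D hdeg)
    (not_three_dvd_tamagawaProduct_of_hasCM_of_not_cmRamified_three W hT.1 hT.2.1.1) hq hv

/-- **The pair's own LOWER half suffices, Manin input from the degree** — the per-pair form of inert
g11's `InertBadOddLowerHalf.missingInputAt_three_IstarZero_of_lower` (p416932 §1) with the datum
`3 ∤ c(D)` replaced by (bad at `2` ∧ `3 ∤ deg(D)`): for `W` of signed type `(3, I₀*)` with `r_an = 1`,
`MissingLowerBoundAt W 3` ⟹ `Typed.X12.MissingInputAt W 3` (upper half: Kolyvagin–Matar–Nekovář, x1b's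
`X12.bsdp_three_of_classX12_of_bad_of_lower`). CONDITIONAL; per pair; nothing booked.
[cite: CesnaviciusNeururerSaha2023, Thm. 1.2] [cite: MatarNekovar2019, Thm. 0.3 and §0.11]
[cite: Miller2011LMS, §1 and Def. 1.1] -/
theorem missingInputAt_three_IstarZero_of_lower_of_modularDegree
    (W : WeierstrassCurve ℚ) [W.IsElliptic] [W.IsGloballyMinimal] [Fact (Nat.Prime 3)]
    [NeZero (W.conductorNorm ℤ)]
    (hT : HasSignedLocalType W 3 (.Istar 0)) (hr : W.analyticRank = 1)
    (hbad2 : ¬ W.HasGoodReductionAtPrime 2)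
    (D : ModularParametrizationData W (W.conductorNorm ℤ)) (hdeg : ¬ 3 ∣ D.modularDegree)
    (hlow : MissingLowerBoundAt W 3) : X12.MissingInputAt W 3 := by
  intro _
  have hB : BSDp W 3 :=
    bsdp_three_of_classX12_of_bad_of_lower hGZ hKo hMN hGZK hmod hnf hFH hCM8 W
      (classX12_of_hasSignedLocalType W 3 hT hr) hT.2.2.1 hT.2.1.1 D
      (not_three_dvd_maninConstant_of_not_good_two_of_not_dvd_modularDegree hCNS W hbad2 D hdeg)
      (not_three_dvd_tamagawaProduct_of_hasCM_of_not_cmRamified_three W hT.1 hT.2.1.1) hlow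
  haveI : Finite W.sha := (hGZK W (by rw [hr])).2
  exact missingPPartAt_of_bsdp W 3 hB

end Facts

/-! ## §3 (appended, same seat, 2026-08-26) The `ℚ(i)`-part of the type: «bad at `2`» is automatic

For a CM curve whose CM field has EVEN discriminant (`CMRamified W 2`; among the fields with `3` inert this
is exactly `K = ℚ(i)`, `d_K = −4`: 143 of the 154 O10@3 census classes, 46 of the 57 on the type `(3, I₀*)`)
the curve is BAD at `2` (x1b gen 7, `X12.not_good_two_of_cmRamified_two`), so §2's hypothesis `hbad2` is
discharged and the Manin input at `3` is the degree datum `3 ∤ deg(D)` ALONE. -/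

section RamifiedTwo

variable
  (hGZ : ∀ (N : ℕ) [NeZero N] (W : WeierstrassCurve ℚ) (K : Type) [Field K] [NumberField K],
    gross_zagier N W K)
  (hKo : ∀ (N : ℕ) [NeZero N] (W : WeierstrassCurve ℚ) (K : Type) [Field K] [NumberField K],
    kolyvagin N W K)
  (hMN : ∀ (N : ℕ) [NeZero N] (W : WeierstrassCurve ℚ) (K : Type) [Field K] [NumberField K],
    MatarNekovar2019.thm03_padicValNat_card_sha_le_of_irreducible N W K)
  (hGZK : rank_eq_analyticRank_of_analyticRank_le_one) (hmod : hasEntireLFunction_rat)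
  (hnf : exists_isNewformOf) (hFH : friedbergHoffstein_exists_heegnerField_split_twist_ne_zero)
  (hCM8 : bsdTriple_of_hasCM_of_L_one_ne_zero)
  (hCNS : cesnaviciusNeururerSaha_padicVal_maninConstant_le_modularDegree)

include hGZ hKo hMN hGZK hmod hnf hFH hCM8 hCNS

/-- **Route T-KR@3 on the type `(3, I₀*)`, CM field ramified at `2` (= `ℚ(i)` here), Manin input =
the degree datum alone**: published facts (+ CNS) + certified `r_an = 1`, `3 ∤ deg(D)`, `ord₃ #Ш_an = 0`
⟹ `Typed.X12.MissingInputAt W 3`. CONDITIONAL; per pair; nothing booked.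
[cite: CesnaviciusNeururerSaha2023, Thm. 1.2] [cite: MatarNekovar2019, Thm. 0.3 and §0.11]
[cite: SilvermanAEC2009, Cor. VII.7.2] -/
theorem missingInputAt_three_IstarZero_of_shaAn_unit_of_modularDegree_of_cmRamified_two
    (W : WeierstrassCurve ℚ) [W.IsElliptic] [W.IsGloballyMinimal] [Fact (Nat.Prime 3)]
    [NeZero (W.conductorNorm ℤ)]
    (hT : HasSignedLocalType W 3 (.Istar 0)) (hr : W.analyticRank = 1) (h2 : CMRamified W 2)
    (D : ModularParametrizationData W (W.conductorNorm ℤ)) (hdeg : ¬ 3 ∣ D.modularDegree)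
    {q : ℚ} (hq : shaAn W = (q : ℂ)) (hv : padicValRat 3 q = 0) :
    X12.MissingInputAt W 3 :=
  haveI : Fact (Nat.Prime 2) := ⟨Nat.prime_two⟩
  missingInputAt_three_IstarZero_of_shaAn_unit_of_modularDegree hGZ hKo hMN hGZK hmod hnf hFH hCM8 hCNS
    W hT hr (not_good_two_of_cmRamified_two W hT.1 h2) D hdeg hq hv

/-- **… and with the pair's own LOWER half in place of the `#Ш_an` certificate** (CM field ramified at
`2`, Manin input = the degree datum alone). CONDITIONAL; per pair; nothing booked.
[cite: CesnaviciusNeururerSaha2023, Thm. 1.2] [cite: MatarNekovar2019, Thm. 0.3 and §0.11]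
[cite: Miller2011LMS, §1 and Def. 1.1] -/
theorem missingInputAt_three_IstarZero_of_lower_of_modularDegree_of_cmRamified_two
    (W : WeierstrassCurve ℚ) [W.IsElliptic] [W.IsGloballyMinimal] [Fact (Nat.Prime 3)]
    [NeZero (W.conductorNorm ℤ)]
    (hT : HasSignedLocalType W 3 (.Istar 0)) (hr : W.analyticRank = 1) (h2 : CMRamified W 2)
    (D : ModularParametrizationData W (W.conductorNorm ℤ)) (hdeg : ¬ 3 ∣ D.modularDegree)
    (hlow : MissingLowerBoundAt W 3) : X12.MissingInputAt W 3 :=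
  haveI : Fact (Nat.Prime 2) := ⟨Nat.prime_two⟩
  missingInputAt_three_IstarZero_of_lower_of_modularDegree hGZ hKo hMN hGZK hmod hnf hFH hCM8 hCNS
    W hT hr (not_good_two_of_cmRamified_two W hT.1 h2) D hdeg hlow

end RamifiedTwo

end Summit.BirchSwinnertonDyer.BirchSwinnertonDyer.Theorems.InertBadManinDegree

end
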